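import Summits.AtomisticToContinuum.BoseEinsteinCondensation.Theses.BECTangentRigidity

/-!
# AtomisticToContinuum / BoseEinsteinCondensation — route `BECTangentRigidity`, assembly

Settles the assembly item `stmt-AtomisticToContinuum-13038` of route
`route-AtomisticToContinuum-BECTangentRigidity`: the implication

  `MesoscopicFloor → RigidMomentumBound → TangentTransfer → CoarsePigeonhole →
   BoseEinsteinCondensation`.

Pure logic; no analytic content lives here. For each admissible pair potential `v`
(`IsRepulsiveFiniteRange v`), the crux `TangentTransfer` consumes, verbatim, the `v`-instances of
`MesoscopicFloor` (local condensation on an `N`-independent window) and of `RigidMomentumBound`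
(total-momentum fluctuation `o(N²/L²)`) and returns the `v`-instance of the target
`CoarseCoherence` (coarse coherence `≥ N/2` at a fixed dyadic level `K`); the support item
`CoarsePigeonhole`, whose hypothesis is definitionally `CoarseCoherence`, turns that into the
sub-problem statement `_root_.BoseEinsteinCondensation`. This is the route's deciding theorem
`closes` with the glue item `TransferGlue` (`fun hF hS hT v hv => hT v hv (hF v hv) (hS v hv)`)
inlined.

References: [LSSY2005] Lieb–Seiringer–Solovej–Yngvason, *The Mathematics of the Bose Gas and its
Condensation* (2005) (vocabulary only).
-/

namespace Summit.AtomisticToContinuum.BoseEinsteinCondensation.Theorems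

/-- Settles `stmt-AtomisticToContinuum-13038` (exact signature): the assembly of route
`BECTangentRigidity`, i.e. `MesoscopicFloor → RigidMomentumBound → TangentTransfer →
CoarsePigeonhole → BoseEinsteinCondensation`. Proof: `CoarsePigeonhole` applied to the coarse
coherence obtained, for each admissible `v`, by feeding `TangentTransfer v hv` the `v`-instances
of `MesoscopicFloor` and `RigidMomentumBound`. [folklore] -/
theorem becTangentRigidity_assembly_proof :
    Summit.AtomisticToContinuum.BoseEinsteinCondensation.Theses.BECTangentRigidity.Assembly := by
  unfold Theses.BECTangentRigidity.Assembly
  intro hF hS hT hP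
  exact hP (fun v hv => hT v hv (hF v hv) (hS v hv))

end Summit.AtomisticToContinuum.BoseEinsteinCondensation.Theorems
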